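import Literature.Computability.Cryptography.XorCombiner
import Literature.Computability.Cryptography.PRGStretchExtensionReduction
import Literature.Computability.Cryptography.PseudorandomGeneratorsAllLengths
import HarnessLib

/-!
# From a mildly non-uniform pseudorandom generator to a pseudorandom generator (Håstad–Impagliazzo–Levin–Luby 1999, Prop. 4.8.1 with Prop. 3.3.4)

HILL 1999 (SIAM J. Comput. 28; authors' preprint `galaxy-pdf--8752169249696178760`), §2.3 and §4.8:

> **Definition 2.3.3** … We say `f` is a *mildly non-uniform* **P**-time function ensemble if it is a **P**-time
> function ensemble except that it has an additional input `aₙ` called the advice, that is an integer-valued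
> polynomial parameter that is not necessarily **P**-time computable.
>
> **Proposition 4.8.1** Let `aₙ` be any value in `{0, …, kₙ}`, where `kₙ` is an integer-valued **P**-time
> polynomial parameter. Let `g : {0,1}^{⌈log kₙ⌉} × {0,1}ⁿ → {0,1}^{ℓₙ}` be a **P**-time function ensemble,
> where `ℓₙ > n kₙ`. Let `x' ∈ {0,1}^{kₙ × n}` and define `g'(x') = ⊕_{i=1}^{kₙ} g(i, x'ᵢ)`. Let `g` be a mildly
> non-uniform pseudorandom generator when the first input is set to `aₙ`. Then `g'` is a pseudorandom
> generator. … If `g` in Proposition 4.8.1 does not satisfy the property that `ℓₙ > n kₙ`, then for each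
> fixed `i` we can use Proposition 3.3.4 [iterating a one-bit-stretch generator] to stretch the output of
> `g(i, x)` … into a string of length longer than `n kₙ` and then exclusive-or together the stretched outputs.

This file proves the combination in the tree's model, in the *level* format produced by HILL-type
constructions (a generator for each security parameter `N` on seeds of a prescribed polynomial length
`d(N)`, indexed by an advice value `a`; `PseudorandomGeneratorsAllLengths.lean` then passes to all seed
lengths): **`PRGExist_of_advice_levels`** — if `G ∈ FP` reads `⟨1^N, ⟨1^a, s⟩⟩`, and for SOME advice
sequence `a*(N) ≤ q(N)` (`q` a polynomial; `a*` arbitrary, typically not computable) the candidate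
`s ↦ G⟨1^N, ⟨1^{a*(N)}, s⟩⟩` maps `d(N)`-bit seeds to `d(N)+1` bits and `N ↦ G⟨1^N, ⟨1^{a*(N)}, U_{d(N)}⟩⟩` is
pseudorandom against `U_{d(N)+1}`, then pseudorandom generators exist.

* **Prop. 3.3.4 level-wise, with advice** (`AdvStretch`): every candidate is first normalised to a one-bit
  stretcher `oneStep G N a` on every seed length (pad/truncate; transparent on the good candidate), then
  iterated `T(N) = (q(N)+1)(d(N)+N) + 1` times by Goldreich's Construction 3.3.2 (`PRGStretch.gen`); the
  stretched candidates are ONE `FP` sampler `AdvStretch.Sx ⟨1^N, ⟨1^a, s⟩⟩` (a clocked loop carrying the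
  context `⟨1^N, 1^a⟩`, `Sx_mem_FP`, `Sx_apply`). Pseudorandomness of the good stretched candidate
  (`isPseudorandom_stretch`): the hybrid argument of Goldreich's Thm. 3.3.3 exactly as in
  `PRGStretchExtensionReduction.lean`, except that the reduction `AdvStretch.red` must evaluate the good
  candidate and therefore needs `a*(N)`: like the attacked hybrid index `k*(N)` and the coin count of the
  distinguisher, the advice is handed over through the reduction's coin budget (`redCl`; three numbers packed
  as `((κ·B₂ + a*)·B₁ + k*)`) — the device sanctioned by `Indistinguishability.lean` (a PPT machine's coin
  budget is an arbitrary polynomially bounded function of the input length), which is how the tree renders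
  HILL's "mildly non-uniform adversary".
* **Prop. 4.8.1**: the tree's `isPseudorandom_xorCombiner` (`XorCombiner.lean`) on the stretched candidates
  (seeds padded to the polynomial `d + X`, `q(N) + 1` candidates, common output length `T(N) >` total seed
  length), then `PRGExist_of_levels`.

## References

* J. Håstad, R. Impagliazzo, L. A. Levin, M. Luby, SIAM J. Comput. 28 (1999): Def. 2.3.3 (mildly non-uniform),
  Def. 3.1.1 (mildly non-uniform adversary), Prop. 3.3.4 (stretching), Prop. 4.8.1 and the remark after it.
* O. Goldreich, *Foundations of Cryptography I*, CUP 2001: Construction 3.3.2, Thm. 3.3.3 (as vendored in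
  `PRGStretchExtension*.lean`).
-/

namespace Literature.Computability.Cryptography

open Filter Asymptotics _root_.Computability Complexity Complexity.Brick MetaComplexity PRGTrunc
  Polynomial Finset PRGStretch Hybrid XorComb

namespace AdvStretch

variable (G : List Bool → List Bool) (dP qP : Polynomial ℕ)

/-! ### The normalised one-step candidate -/

/-- **The one-step candidate, normalised**: on context strings `u, v` (intended `u = 1^N`, `v = 1^a`) and seed
`t`, the output `G⟨u, ⟨v, t⟩⟩` padded with zeros / truncated to exactly `|t| + 1` bits (so that Goldreich's
Construction 3.3.2 and its machine apply on every string; on the good candidate and a genuine seed this is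
`G`'s output itself, `osW_eq_of_length`). [cite: HastadImpagliazzoLevinLuby1999, Prop. 4.8.1 (remark: stretch each g(i,·) by Prop. 3.3.4)] -/
def osW (u v t : List Bool) : List Bool :=
  (G (boolPair u (boolPair v t)) ++ List.replicate (t.length + 1) false).take (t.length + 1)

/-- The one-step candidate of level `N` and advice `a`. [cite: HastadImpagliazzoLevinLuby1999, Prop. 4.8.1] -/
def oneStep (N a : ℕ) : List Bool → List Bool := osW G (unaryEncodeNat N) (ones a)

/-- `|osW u v t| = |t| + 1` on every string. [folklore] -/
@[simp] theorem length_osW (u v t : List Bool) : (osW G u v t).length = t.length + 1 := by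
  rw [osW, List.length_take, List.length_append, List.length_replicate]; omega

/-- `|oneStep N a t| = |t| + 1`. [folklore] -/
theorem length_oneStep (N a : ℕ) (t : List Bool) : (oneStep G N a t).length = t.length + 1 := length_osW G _ _ t

/-- The normalisation is transparent when `G`'s output already has length `|t| + 1`. [folklore] -/
theorem osW_eq_of_length {u v t : List Bool} (h : (G (boolPair u (boolPair v t))).length = t.length + 1) :
    osW G u v t = G (boolPair u (boolPair v t)) := by
  rw [osW, List.take_append_of_le_length h.ge, List.take_of_length_le h.le]

/-! ### Parameters -/

/-- The padded seed length of a candidate, `d + X` (strictly increasing). [folklore] -/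
noncomputable def aP : Polynomial ℕ := dP + X
/-- The number of candidates, `q + 1`. [folklore] -/
noncomputable def mP : Polynomial ℕ := qP + 1
/-- The common output length `T = (q+1)(d+X) + 1` (one more than the total seed length of the XOR). [folklore] -/
noncomputable def TP : Polynomial ℕ := (qP + 1) * (dP + X) + 1

/-- Value of `aP`. [folklore] -/
@[simp] theorem aP_eval (N : ℕ) : (aP dP).eval N = dP.eval N + N := by simp [aP]
/-- Value of `mP`. [folklore] -/
@[simp] theorem mP_eval (N : ℕ) : (mP qP).eval N = qP.eval N + 1 := by simp [mP]
/-- Value of `TP`. [folklore] -/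
@[simp] theorem TP_eval (N : ℕ) : (TP dP qP).eval N = (qP.eval N + 1) * (dP.eval N + N) + 1 := by simp [TP]

/-- `0 < T(N)`. [folklore] -/
theorem TP_pos (N : ℕ) : 0 < (TP dP qP).eval N := by rw [TP_eval]; omega

/-! ### The machine of Construction 3.3.2 carrying the context `⟨u, v⟩` -/

section Machine

/-- The one-step candidate on `⟨⟨u, v⟩, t⟩`. [folklore] -/
noncomputable def osP (z : List Bool) : List Bool :=
  Plumb.takeFn (boolPair (true :: sndF z)
    (G (boolPair (fstF (fstF z)) (boolPair (sndF (fstF z)) (sndF z))) ++ Kannan.zerosFn (true :: sndF z)))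

/-- Value of `osP`. [folklore] -/
theorem osP_boolPair (u v t : List Bool) : osP G (boolPair (boolPair u v) t) = osW G u v t := by
  simp [osP, osW, Kannan.zerosFn_apply]

/-- `osP ∈ FP` for `G ∈ FP`. [Arora–Barak 2009, §1.3] [folklore] -/
theorem osP_mem_FP (hG : G ∈ FP) : osP G ∈ FP :=
  (comp_mem_FP' Plumb.takeFn_mem_FP (pair_mem_FP (comp_mem_FP' (cons_mem_FP true) sndF_mem_FP)
    (append_mem_FP (comp_mem_FP' hG (pair_mem_FP (comp_mem_FP' fstF_mem_FP fstF_mem_FP)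
      (pair_mem_FP (comp_mem_FP' sndF_mem_FP fstF_mem_FP) sndF_mem_FP)))
      (comp_mem_FP' Kannan.zerosFn_mem_FP (comp_mem_FP' (cons_mem_FP true) sndF_mem_FP)))) :)

/-- One round on `⟨acc, ⟨ctx, t⟩⟩`: append the first bit of the candidate's output, keep its suffix (and the
context). [cite: Goldreich2001, Construction 3.3.2] -/
noncomputable def round₀ (z : List Bool) : List Bool :=
  boolPair (fstF z ++ take1Fn (osP G (sndF z))) (boolPair (fstF (sndF z)) (Plumb.dropFn (boolPair [true] (osP G (sndF z)))))

/-- Value of one round. [folklore] -/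
theorem round₀_boolPair (acc u v t : List Bool) :
    round₀ G (boolPair acc (boolPair (boolPair u v) t)) =
      boolPair (acc ++ (osW G u v t).take 1) (boolPair (boolPair u v) ((osW G u v t).drop 1)) := by
  simp [round₀, osP_boolPair, take1Fn]

/-- `round₀ ∈ FP`. [folklore] -/
theorem round₀_mem_FP (hG : G ∈ FP) : round₀ G ∈ FP :=
  (pair_mem_FP (append_mem_FP fstF_mem_FP (comp_mem_FP' take1Fn_mem_FP (comp_mem_FP' (osP_mem_FP G hG) sndF_mem_FP)))
    (pair_mem_FP (comp_mem_FP' fstF_mem_FP sndF_mem_FP) (comp_mem_FP' Plumb.dropFn_mem_FP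
      (pair_mem_FP (const_mem_FP _) (comp_mem_FP' (osP_mem_FP G hG) sndF_mem_FP)))) :)

/-- One round on the full state `⟨clock, ⟨acc, ⟨ctx, t⟩⟩⟩`, clamped to additive growth `2`. [folklore] -/
noncomputable def roundF : List Bool → List Bool := clampAdd 2 (mapSndFn (round₀ G))

/-- `roundF ∈ FP`. [folklore] -/
theorem roundF_mem_FP (hG : G ∈ FP) : roundF G ∈ FP := clampAdd_mem_FP 2 (mapSndFn_mem_FP (round₀_mem_FP G hG))

/-- **Value of one clamped round** (the clamp is transparent: the state grows by exactly two symbols, since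
`|osW u v t| = |t| + 1` on every string). [folklore] -/
theorem roundF_state (c acc u v t : List Bool) :
    roundF G (boolPair c (boolPair acc (boolPair (boolPair u v) t))) =
      boolPair c (boolPair (acc ++ (osW G u v t).take 1) (boolPair (boolPair u v) ((osW G u v t).drop 1))) := by
  have hval : mapSndFn (round₀ G) (boolPair c (boolPair acc (boolPair (boolPair u v) t))) =
      boolPair c (boolPair (acc ++ (osW G u v t).take 1) (boolPair (boolPair u v) ((osW G u v t).drop 1))) := by
    rw [mapSndFn_boolPair, round₀_boolPair]
  rw [roundF, clampAdd_eq_of_le (by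
    rw [hval]
    simp only [length_boolPair, List.length_append, List.length_take, List.length_drop, length_osW]
    omega), hval]

/-- **`m` rounds generate `m` bits.** [cite: Goldreich2001, Construction 3.3.2] -/
theorem iterate_roundF (c u v : List Bool) : ∀ (m : ℕ) (acc t : List Bool),
    (roundF G)^[m] (boolPair c (boolPair acc (boolPair (boolPair u v) t))) =
      boolPair c (boolPair (acc ++ gen (osW G u v) m t) (boolPair (boolPair u v) (st (osW G u v) m t))) := by
  intro m
  induction m with
  | zero => intro acc t; simp
  | succ m ih =>
    intro acc t
    rw [Function.iterate_succ_apply, roundF_state, ih, gen_succ, st_succ, List.append_assoc]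

/-- The clocked loop. [folklore] -/
noncomputable def loopF (z : List Bool) : List Bool := (roundF G)^[(X : Polynomial ℕ).eval (boolUnpair z).1.length] z

/-- The clocked loop is in `FP`. [Arora–Barak 2009, §1.4.1] [cite: AroraBarakCC2009, §1.4.1] -/
theorem loopF_mem_FP (hG : G ∈ FP) : loopF G ∈ FP := iterate_mem_FP (roundF_mem_FP G hG) 2 (length_clampAdd_le 2 _) X

/-- **Value of the loop.** [folklore] -/
theorem loopF_boolPair (c u v t : List Bool) :
    loopF G (boolPair c (boolPair [] (boolPair (boolPair u v) t))) =
      boolPair c (boolPair (gen (osW G u v) c.length t) (boolPair (boolPair u v) (st (osW G u v) c.length t))) := by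
  unfold loopF
  rw [boolUnpair_boolPair, eval_X]
  have h := iterate_roundF G c u v c.length [] t
  rwa [List.nil_append] at h

/-- **The sampler of the stretched candidates**: `Sx ⟨u, ⟨v, s⟩⟩ = gen (osW u v) T(|u|) (s ↾ d(|u|))`.
[cite: HastadImpagliazzoLevinLuby1999, Prop. 4.8.1 with Prop. 3.3.4] -/
noncomputable def Sx (z : List Bool) : List Bool :=
  fstF (sndF (loopF G (boolPair (Plumb.polyFn (TP dP qP) (fstF z))
    (boolPair [] (boolPair (boolPair (fstF z) (fstF (sndF z))) (Plumb.takeFn (boolPair (Plumb.polyFn dP (fstF z)) (sndF (sndF z)))))))))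

/-- **Value of `Sx`.** [folklore] -/
theorem Sx_apply (u v s : List Bool) :
    Sx G dP qP (boolPair u (boolPair v s)) = gen (osW G u v) ((TP dP qP).eval u.length) (s.take (dP.eval u.length)) := by
  rw [Sx, fstF_boolPair, sndF_boolPair, fstF_boolPair, sndF_boolPair, Plumb.polyFn_apply, Plumb.polyFn_apply, Plumb.takeFn_boolPair,
    loopF_boolPair, sndF_boolPair, fstF_boolPair]
  simp [ones]

/-- `Sx ∈ FP` for `G ∈ FP`. [Arora–Barak 2009, §1.3–1.4] [cite: AroraBarakCC2009, §1.3] -/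
theorem Sx_mem_FP (hG : G ∈ FP) : Sx G dP qP ∈ FP := by
  have h : (fun z => fstF (sndF (loopF G (boolPair (Plumb.polyFn (TP dP qP) (fstF z))
      (boolPair [] (boolPair (boolPair (fstF z) (fstF (sndF z))) (Plumb.takeFn (boolPair (Plumb.polyFn dP (fstF z)) (sndF (sndF z)))))))))) ∈ FP :=
    comp_mem_FP' fstF_mem_FP (comp_mem_FP' sndF_mem_FP (comp_mem_FP' (loopF_mem_FP G hG)
      (pair_mem_FP (comp_mem_FP' (Plumb.polyFn_mem_FP _) fstF_mem_FP) (pair_mem_FP (const_mem_FP [])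
        (pair_mem_FP (pair_mem_FP fstF_mem_FP (comp_mem_FP' fstF_mem_FP sndF_mem_FP))
          (comp_mem_FP' Plumb.takeFn_mem_FP (pair_mem_FP (comp_mem_FP' (Plumb.polyFn_mem_FP _) fstF_mem_FP)
            (comp_mem_FP' sndF_mem_FP sndF_mem_FP))))))))
  exact h

/-- `|1ⁿ| = n`. [folklore] -/
private theorem length_unary (n : ℕ) : (unaryEncodeNat n).length = n := unary_decode_encode_nat n

/-- **`Sx` on a genuine input** `⟨1^N, ⟨1^a, s⟩⟩`: the `T(N)` bits generated by the one-step candidate of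
level `N`, advice `a`, from `s ↾ d(N)`. [folklore] -/
theorem Sx_level (N a : ℕ) (s : List Bool) :
    Sx G dP qP (boolPair (unaryEncodeNat N) (boolPair (ones a) s)) = gen (oneStep G N a) ((TP dP qP).eval N) (s.take (dP.eval N)) := by
  rw [Sx_apply, length_unary]; rfl

/-- `Sx` has the common output length `T` at every position (`HasOutLenI`). [folklore] -/
theorem hasOutLenI_Sx : HasOutLenI (Sx G dP qP) (aP dP) (fun N => (TP dP qP).eval N) := by
  intro N i s _
  rw [Sx_level, length_gen (fun t => by
    intro h; have := length_oneStep G N i t; rw [h] at this; exact Nat.succ_ne_zero _ this.symm)]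

end Machine

/-! ### The reduction `D'` (Goldreich's algorithm `D'`, reading the advice off its coin budget) -/

section Red

/-- `B₁(N) = T(N) + 1`: separates the hybrid index `k < T(N)`. [folklore] -/
noncomputable def bm1 (N : ℕ) : ℕ := (TP dP qP).eval N + 1
/-- `B₂(N) = q(N) + 1`: separates the advice `a ≤ q(N)`. [folklore] -/
noncomputable def bm2 (N : ℕ) : ℕ := qP.eval N + 1

/-- `N` read off the game input `⟨1^N, α⟩` (the length of its first field). [folklore] -/
def nOf (inp : List Bool) : ℕ := (boolUnpair inp).1.length
/-- The hybrid index `k = |r| mod B₁`. [folklore] -/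
noncomputable def kOf (inp r : List Bool) : ℕ := r.length % bm1 dP qP (nOf inp)
/-- `|r| / B₁`. [folklore] -/
noncomputable def r1Of (inp r : List Bool) : ℕ := r.length / bm1 dP qP (nOf inp)
/-- The advice `a = (|r| / B₁) mod B₂`. [folklore] -/
noncomputable def advOf (inp r : List Bool) : ℕ := r1Of dP qP inp r % bm2 qP (nOf inp)
/-- The coin count of `D`: `κ = (|r| / B₁) / B₂`. [folklore] -/
noncomputable def kapOf (inp r : List Bool) : ℕ := r1Of dP qP inp r / bm2 qP (nOf inp)

/-- The hybrid sample assembled by `D'`: `β · f_{T−k}(α)` with `β` the first `k` coins and the generated part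
computed with the candidate of advice `a`. [cite: Goldreich2001, Thm. 3.3.3 (proof, algorithm D')] -/
noncomputable def redWord (inp r : List Bool) : List Bool :=
  r.take (kOf dP qP inp r) ++
    PRGStretch.ext (osW G (boolUnpair inp).1 (ones (advOf dP qP inp r))) ((TP dP qP).eval (nOf inp) - kOf dP qP inp r - 1) (boolUnpair inp).2

/-- The coins handed to `D`. [folklore] -/
noncomputable def redCoins (inp r : List Bool) : List Bool := (r.drop (kOf dP qP inp r)).take (kapOf dP qP inp r)

/-- **The run function of `D'`.** [cite: HastadImpagliazzoLevinLuby1999, Prop. 4.8.1 (proof: the oracle machine M^{(A)}(i)) with Goldreich2001 Thm. 3.3.3 (algorithm D')] -/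
noncomputable def redRun (D : RandAlg (List Bool) Bool) (inp r : List Bool) : Bool :=
  D.run (boolPair (boolUnpair inp).1 (redWord G dP qP inp r)) (redCoins dP qP inp r)

/-- **The reduction `D'`** with a prescribed coin budget. [cite: HastadImpagliazzoLevinLuby1999, Prop. 4.8.1 with Prop. 3.3.4] -/
noncomputable def red (D : RandAlg (List Bool) Bool) (cl : ℕ → ℕ) : RandAlg (List Bool) Bool where
  run := redRun G dP qP D
  coinLen := cl

/-! #### The run function is a pipeline of `FP` bricks -/

/-- `⟨1^{|r| / B₁}, 1^{|r| mod B₁}⟩`. [folklore] -/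
noncomputable def dm1F (z : List Bool) : List Bool :=
  Plumb.divModFn (boolPair (Plumb.polyFn (TP dP qP + 1) (fstF (fstF z))) (onesFn (sndF z)))
/-- `1ᵏ`. [folklore] -/
noncomputable def kU (z : List Bool) : List Bool := sndF (dm1F dP qP z)
/-- `⟨1^κ, 1^a⟩`. [folklore] -/
noncomputable def dm2F (z : List Bool) : List Bool :=
  Plumb.divModFn (boolPair (Plumb.polyFn (qP + 1) (fstF (fstF z))) (fstF (dm1F dP qP z)))
/-- `1^a`. [folklore] -/
noncomputable def aU (z : List Bool) : List Bool := sndF (dm2F dP qP z)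
/-- `1^κ`. [folklore] -/
noncomputable def kapU (z : List Bool) : List Bool := fstF (dm2F dP qP z)
/-- `β = r ↾ k`. [folklore] -/
noncomputable def betaF (z : List Bool) : List Bool := Plumb.takeFn (boolPair (kU dP qP z) (sndF z))
/-- The coins of `D`. [folklore] -/
noncomputable def rhoF (z : List Bool) : List Bool :=
  Plumb.takeFn (boolPair (kapU dP qP z) (Plumb.dropFn (boolPair (kU dP qP z) (sndF z))))
/-- The loop count `1^{T − k − 1}`. [folklore] -/
noncomputable def cntF (z : List Bool) : List Bool :=
  Plumb.dropFn (boolPair (true :: kU dP qP z) (Plumb.polyFn (TP dP qP) (fstF (fstF z))))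
/-- The generated suffix (the loop of Construction 3.3.2 on the candidate of advice `a`). [folklore] -/
noncomputable def genF (z : List Bool) : List Bool :=
  fstF (sndF (loopF G (boolPair (cntF dP qP z) (boolPair []
    (boolPair (boolPair (fstF (fstF z)) (aU dP qP z)) (Plumb.dropFn (boolPair [true] (sndF (fstF z)))))))))
/-- The whole preprocessing `⟨inp, r⟩ ↦ ⟨⟨1^N, β · f(α)⟩, ρ⟩`. [folklore] -/
noncomputable def preF (z : List Bool) : List Bool :=
  boolPair (boolPair (fstF (fstF z)) (betaF dP qP z ++ (take1Fn (sndF (fstF z)) ++ genF G dP qP z))) (rhoF dP qP z)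

/-- `preF ∈ FP` for `G ∈ FP`. [Arora–Barak 2009, §1.3–1.4] [cite: AroraBarakCC2009, §1.3] -/
theorem preF_mem_FP (hG : G ∈ FP) : preF G dP qP ∈ FP := by
  have hdm1 : dm1F dP qP ∈ FP := (comp_mem_FP' Plumb.divModFn_mem_FP (pair_mem_FP
    (comp_mem_FP' (Plumb.polyFn_mem_FP _) (comp_mem_FP' fstF_mem_FP fstF_mem_FP)) (comp_mem_FP' onesFn_mem_FP sndF_mem_FP)) :)
  have hk : kU dP qP ∈ FP := (comp_mem_FP' sndF_mem_FP hdm1 :)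
  have hdm2 : dm2F dP qP ∈ FP := (comp_mem_FP' Plumb.divModFn_mem_FP (pair_mem_FP
    (comp_mem_FP' (Plumb.polyFn_mem_FP _) (comp_mem_FP' fstF_mem_FP fstF_mem_FP)) (comp_mem_FP' fstF_mem_FP hdm1)) :)
  have ha : aU dP qP ∈ FP := (comp_mem_FP' sndF_mem_FP hdm2 :)
  have hkap : kapU dP qP ∈ FP := (comp_mem_FP' fstF_mem_FP hdm2 :)
  have hbeta : betaF dP qP ∈ FP := (comp_mem_FP' Plumb.takeFn_mem_FP (pair_mem_FP hk sndF_mem_FP) :)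
  have hrho : rhoF dP qP ∈ FP := (comp_mem_FP' Plumb.takeFn_mem_FP (pair_mem_FP hkap
    (comp_mem_FP' Plumb.dropFn_mem_FP (pair_mem_FP hk sndF_mem_FP))) :)
  have hcnt : cntF dP qP ∈ FP := (comp_mem_FP' Plumb.dropFn_mem_FP (pair_mem_FP (comp_mem_FP' (cons_mem_FP true) hk)
    (comp_mem_FP' (Plumb.polyFn_mem_FP _) (comp_mem_FP' fstF_mem_FP fstF_mem_FP))) :)
  have hgen : genF G dP qP ∈ FP := (comp_mem_FP' fstF_mem_FP (comp_mem_FP' sndF_mem_FP (comp_mem_FP' (loopF_mem_FP G hG)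
    (pair_mem_FP hcnt (pair_mem_FP (const_mem_FP []) (pair_mem_FP (pair_mem_FP (comp_mem_FP' fstF_mem_FP fstF_mem_FP) ha)
      (comp_mem_FP' Plumb.dropFn_mem_FP (pair_mem_FP (const_mem_FP [true]) (comp_mem_FP' sndF_mem_FP fstF_mem_FP)))))))) :)
  exact (pair_mem_FP (pair_mem_FP (comp_mem_FP' fstF_mem_FP fstF_mem_FP)
    (append_mem_FP hbeta (append_mem_FP (comp_mem_FP' take1Fn_mem_FP (comp_mem_FP' sndF_mem_FP fstF_mem_FP)) hgen))) hrho :)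

/-- `unaryEncodeNat n = 1ⁿ` as a block of ones. [folklore] -/
private theorem unaryEncodeNat_eq_ones (n : ℕ) : unaryEncodeNat n = ones n := unaryEncodeNat_eq_replicate n

/-- Value of `dm1F`. [folklore] -/
theorem dm1F_boolPair (inp r : List Bool) :
    dm1F dP qP (boolPair inp r) = boolPair (ones (r1Of dP qP inp r)) (ones (kOf dP qP inp r)) := by
  simp only [dm1F, fstF_boolPair, sndF_boolPair, Plumb.polyFn_apply, onesFn, unaryEncodeNat_eq_ones, Plumb.divModFn_boolPair,
    eval_add, eval_one]
  rfl

/-- Value of `dm2F`. [folklore] -/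
theorem dm2F_boolPair (inp r : List Bool) :
    dm2F dP qP (boolPair inp r) = boolPair (ones (kapOf dP qP inp r)) (ones (advOf dP qP inp r)) := by
  rw [dm2F, dm1F_boolPair, fstF_boolPair, fstF_boolPair, Plumb.polyFn_apply, Plumb.divModFn_boolPair]
  simp only [eval_add, eval_one, ones]
  rfl

/-- **Value of the preprocessing** on every machine input. [folklore] -/
theorem preF_boolPair (inp r : List Bool) :
    preF G dP qP (boolPair inp r) = boolPair (boolPair (boolUnpair inp).1 (redWord G dP qP inp r)) (redCoins dP qP inp r) := by
  have hk : kU dP qP (boolPair inp r) = ones (kOf dP qP inp r) := by rw [kU, dm1F_boolPair, sndF_boolPair]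
  have ha : aU dP qP (boolPair inp r) = ones (advOf dP qP inp r) := by rw [aU, dm2F_boolPair, sndF_boolPair]
  have hkap : kapU dP qP (boolPair inp r) = ones (kapOf dP qP inp r) := by rw [kapU, dm2F_boolPair, fstF_boolPair]
  have hbeta : betaF dP qP (boolPair inp r) = r.take (kOf dP qP inp r) := by
    rw [betaF, hk, sndF_boolPair, Plumb.takeFn_boolPair, List.length_replicate]
  have hrho : rhoF dP qP (boolPair inp r) = redCoins dP qP inp r := by
    rw [rhoF, hkap, hk, sndF_boolPair, Plumb.dropFn_boolPair, Plumb.takeFn_boolPair, List.length_replicate, List.length_replicate, redCoins]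
  have hcnt : cntF dP qP (boolPair inp r) = ones ((TP dP qP).eval (nOf inp) - kOf dP qP inp r - 1) := by
    rw [cntF, hk, fstF_boolPair, Plumb.polyFn_apply, Plumb.dropFn_boolPair, List.length_cons]
    simp only [ones, List.length_replicate, List.drop_replicate, Nat.sub_sub, nOf, fstF]
  have hgen : genF G dP qP (boolPair inp r) =
      gen (osW G (boolUnpair inp).1 (ones (advOf dP qP inp r))) ((TP dP qP).eval (nOf inp) - kOf dP qP inp r - 1) ((boolUnpair inp).2.drop 1) := by
    rw [genF, hcnt, ha, fstF_boolPair, Plumb.dropFn_boolPair, loopF_boolPair, sndF_boolPair, fstF_boolPair]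
    simp [ones, fstF, sndF]
  rw [preF, hbeta, hrho, hgen, fstF_boolPair]
  simp [redWord, PRGStretch.ext, take1Fn, fstF, sndF]

/-- **`D'` is PPT** for a PPT `D`, `G ∈ FP` and a polynomially bounded budget. [cite: HastadImpagliazzoLevinLuby1999, Prop. 4.8.1 (proof: "the running time for M^{(A)}(i) is the running time for A plus …")] -/
theorem isPPT_red {D : RandAlg (List Bool) Bool} (hD : IsPPT D encodeBool) (hG : G ∈ FP)
    {cl : ℕ → ℕ} (hcl : ∃ q : Polynomial ℕ, ∀ L, cl L ≤ q.eval L) : IsPPT (red G dP qP D cl) encodeBool := by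
  refine ⟨?_, hcl⟩
  have hpre : PolyTimeComputable (fun p : List Bool × List Bool => boolPair (id p.1) p.2)
      (fun p : List Bool × List Bool => boolPair (id p.1) p.2)
      (fun p : List Bool × List Bool =>
        (boolPair (boolUnpair p.1).1 (redWord G dP qP p.1 p.2), redCoins dP qP p.1 p.2)) :=
    (preF_mem_FP G dP qP hG).of_comp_encode (fun p => boolPair p.1 p.2) (fun _ => rfl)
      (fun p => by simpa using (preF_boolPair G dP qP p.1 p.2).symm)
  exact PolyTimeComputable.comp_holds hD.1 hpre

end Red

/-! ### The laws of `D'` -/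

section Laws

variable {G dP qP}

/-- `|1ⁿ| = n`. [folklore] -/
private theorem length_unary' (n : ℕ) : (unaryEncodeNat n).length = n := unary_decode_encode_nat n

/-- Decoding the packed budget `(κ B₂ + a) B₁ + k`. [folklore] -/
private theorem decode_pack {κ B₁ B₂ a k : ℕ} (hk : k < B₁) (ha : a < B₂) :
    ((κ * B₂ + a) * B₁ + k) % B₁ = k ∧ ((κ * B₂ + a) * B₁ + k) / B₁ % B₂ = a ∧ ((κ * B₂ + a) * B₁ + k) / B₁ / B₂ = κ := by
  have hB₁ : 0 < B₁ := by omega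
  have hB₂ : 0 < B₂ := by omega
  have h1 : ((κ * B₂ + a) * B₁ + k) / B₁ = κ * B₂ + a := by
    rw [Nat.mul_comm, Nat.mul_add_div hB₁, Nat.div_eq_of_lt hk, Nat.add_zero]
  refine ⟨?_, ?_, ?_⟩
  · rw [Nat.mul_comm, Nat.mul_add_mod, Nat.mod_eq_of_lt hk]
  · rw [h1, Nat.mul_comm, Nat.mul_add_mod, Nat.mod_eq_of_lt ha]
  · rw [h1, Nat.mul_comm, Nat.mul_add_div hB₂, Nat.div_eq_of_lt ha, Nat.add_zero]

/-- Packing: `(κ B₂ + a) B₁ + k = k + (κ + (κ (B₂ B₁ − 1) + a B₁))` for `B₁, B₂ ≥ 1`. [folklore] -/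
private theorem pack_eq (κ a k : ℕ) {B₁ B₂ : ℕ} (hB₁ : 1 ≤ B₁) (hB₂ : 1 ≤ B₂) :
    (κ * B₂ + a) * B₁ + k = k + (κ + (κ * (B₂ * B₁ - 1) + a * B₁)) := by
  have h : 1 ≤ B₂ * B₁ := Nat.one_le_iff_ne_zero.2 (Nat.mul_ne_zero (by omega) (by omega))
  obtain ⟨c, hc⟩ : ∃ c, B₂ * B₁ = c + 1 := ⟨B₂ * B₁ - 1, by omega⟩
  rw [hc, Nat.add_sub_cancel]
  nlinarith [hc]

/-- **The output law of `D'`** with index `k`, advice `a`, on `⟨1^N, α⟩` (`|α| = d(N) + 1`), when its budget at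
this input length is `(κ·B₂ + a)·B₁ + k` with `κ` the coin count of `D` on `T(N)`-bit samples: draw `β ← U_k`
and run `D` on `⟨1^N, β · f_{T−k}(α)⟩` assembled with the candidate of advice `a`.
[cite: Goldreich2001, Thm. 3.3.3 (proof, Claim 3.3.3.2)] -/
theorem outputPMF_red {D : RandAlg (List Bool) Bool} {cl : ℕ → ℕ} {N k a : ℕ} (hk : k < (TP dP qP).eval N) (ha : a ≤ qP.eval N)
    (hcl : cl (2 * N + 2 + (dP.eval N + 1)) = (D.coinLen (2 * N + 2 + (TP dP qP).eval N) * bm2 qP N + a) * bm1 dP qP N + k)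
    {α : List Bool} (hα : α.length = dP.eval N + 1) :
    (red G dP qP D cl).outputPMF id (boolPair (unaryEncodeNat N) α) =
      (uniformBits k).bind fun b =>
        D.outputPMF id (boolPair (unaryEncodeNat N) (b ++ PRGStretch.ext (oneStep G N a) ((TP dP qP).eval N - k - 1) α)) := by
  have hlen := length_oneStep G N a
  have hαne : α ≠ [] := by intro h; rw [h] at hα; exact Nat.succ_ne_zero _ hα.symm
  have hkB : k < bm1 dP qP N := by unfold bm1; omega
  have haB : a < bm2 qP N := by unfold bm2; omega
  have hB1 : 1 ≤ bm1 dP qP N := by unfold bm1; omega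
  have hB2 : 1 ≤ bm2 qP N := by unfold bm2; omega
  set κ := D.coinLen (2 * N + 2 + (TP dP qP).eval N) with hκ
  have hL : (boolPair (unaryEncodeNat N) α).length = 2 * N + 2 + (dP.eval N + 1) := by
    rw [length_boolPair, length_unary', hα]
  have hx : (boolUnpair (boolPair (unaryEncodeNat N) α)).1 = unaryEncodeNat N := by rw [boolUnpair_boolPair]
  have hα' : (boolUnpair (boolPair (unaryEncodeNat N) α)).2 = α := by rw [boolUnpair_boolPair]
  have hnOf : nOf (boolPair (unaryEncodeNat N) α) = N := by rw [nOf, hx, length_unary']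
  obtain ⟨hd1, hd2, hd3⟩ := decode_pack (κ := κ) hkB haB
  -- the run function on coin strings of the prescribed length
  have hrun : ∀ r : List Bool, r.length = (κ * bm2 qP N + a) * bm1 dP qP N + k →
      (red G dP qP D cl).run (boolPair (unaryEncodeNat N) α) r =
        D.run (boolPair (unaryEncodeNat N) (r.take k ++ PRGStretch.ext (oneStep G N a) ((TP dP qP).eval N - k - 1) α)) ((r.drop k).take κ) := by
    intro r hr
    have hkOf : kOf dP qP (boolPair (unaryEncodeNat N) α) r = k := by rw [kOf, hnOf, hr]; exact hd1
    have hadv : advOf dP qP (boolPair (unaryEncodeNat N) α) r = a := by rw [advOf, r1Of, hnOf, hr]; exact hd2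
    have hkap : kapOf dP qP (boolPair (unaryEncodeNat N) α) r = κ := by rw [kapOf, r1Of, hnOf, hr]; exact hd3
    show redRun G dP qP D _ r = _
    rw [redRun, redWord, redCoins, hkOf, hkap, hadv, hx, hα', hnOf]
    rfl
  rw [outputPMF_eq_map_uniformBits]
  have hcoin : (red G dP qP D cl).coinLen (boolPair (unaryEncodeNat N) α).length = k + (κ + (κ * (bm2 qP N * bm1 dP qP N - 1) + a * bm1 dP qP N)) := by
    show cl _ = _
    rw [hL, hcl]
    exact pack_eq κ a k hB1 hB2
  rw [hcoin]
  have hmap : (uniformBits (k + (κ + (κ * (bm2 qP N * bm1 dP qP N - 1) + a * bm1 dP qP N)))).map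
      (fun r => (red G dP qP D cl).run (boolPair (unaryEncodeNat N) α) r) =
      (uniformBits (k + (κ + (κ * (bm2 qP N * bm1 dP qP N - 1) + a * bm1 dP qP N)))).map fun r =>
        D.run (boolPair (unaryEncodeNat N) (r.take k ++ PRGStretch.ext (oneStep G N a) ((TP dP qP).eval N - k - 1) α)) ((r.drop k).take κ) := by
    change (uniformBits _).bind _ = (uniformBits _).bind _
    refine pmf_bind_congr_of_mem_support _ fun r hr => ?_
    have hrl := length_eq_of_mem_support_uniformBits hr
    simp only [Function.comp_apply]
    rw [hrun r (by rw [hrl]; exact (pack_eq κ a k hB1 hB2).symm)]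
  rw [hmap, uniformBits_map_split k κ _ fun b ρ =>
    D.run (boolPair (unaryEncodeNat N) (b ++ PRGStretch.ext (oneStep G N a) ((TP dP qP).eval N - k - 1) α)) ρ]
  refine pmf_bind_congr_of_mem_support _ fun b hb => ?_
  have hbl : b.length = k := length_eq_of_mem_support_uniformBits hb
  have hc : D.coinLen (boolPair (unaryEncodeNat N) (b ++ PRGStretch.ext (oneStep G N a) ((TP dP qP).eval N - k - 1) α)).length = κ := by
    rw [length_boolPair, length_unary', List.length_append, hbl, length_ext hlen _ hαne, hκ]
    congr 1
    omega
  rw [outputPMF_eq_map_uniformBits, hc]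

/-- **`D'` on an ensemble versus `D` on the assembled hybrid.** [cite: Goldreich2001, Thm. 3.3.3 (proof, Claim 3.3.3.2)] -/
theorem acceptPMF_red {D : RandAlg (List Bool) Bool} {cl : ℕ → ℕ} {N k a : ℕ} (hk : k < (TP dP qP).eval N) (ha : a ≤ qP.eval N)
    (hcl : cl (2 * N + 2 + (dP.eval N + 1)) = (D.coinLen (2 * N + 2 + (TP dP qP).eval N) * bm2 qP N + a) * bm1 dP qP N + k)
    (X : PMF (List Bool)) (hX : ∀ α ∈ X.support, α.length = dP.eval N + 1) :
    acceptPMF (red G dP qP D cl) N X =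
      acceptPMF D N ((uniformBits k).bind fun b => (X.map (PRGStretch.ext (oneStep G N a) ((TP dP qP).eval N - k - 1))).map fun e => b ++ e) := by
  rw [acceptPMF, acceptPMF]
  have h1 : (X.bind fun α => (red G dP qP D cl).outputPMF id (boolPair (unaryEncodeNat N) α)) =
      X.bind fun α => (uniformBits k).bind fun b =>
        D.outputPMF id (boolPair (unaryEncodeNat N) (b ++ PRGStretch.ext (oneStep G N a) ((TP dP qP).eval N - k - 1) α)) :=
    pmf_bind_congr_of_mem_support X fun α hα => outputPMF_red hk ha hcl (hX α hα)
  rw [h1, PMF.bind_comm, PMF.bind_bind]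
  refine congrArg _ (funext fun b => ?_)
  rw [PMF.bind_map, PMF.bind_map]
  rfl

/-- **Pseudorandom side**: `D'` on the candidate's one-step output accepts with the probability of `D` on the
hybrid `H^k`. [cite: Goldreich2001, Thm. 3.3.3 (proof, Claims 3.3.3.1–3.3.3.2)] -/
theorem acceptPMF_red_map {D : RandAlg (List Bool) Bool} {cl : ℕ → ℕ} {N k a : ℕ} (hk : k < (TP dP qP).eval N) (ha : a ≤ qP.eval N)
    (hcl : cl (2 * N + 2 + (dP.eval N + 1)) = (D.coinLen (2 * N + 2 + (TP dP qP).eval N) * bm2 qP N + a) * bm1 dP qP N + k) :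
    acceptPMF (red G dP qP D cl) N ((uniformBits (dP.eval N)).map (oneStep G N a)) =
      acceptPMF D N (PRGStretch.hyb (oneStep G N a) (dP.eval N) ((TP dP qP).eval N) k) := by
  rw [acceptPMF_red hk ha hcl _ fun α hα => ?_, hyb_eq_of_lt _ hk]
  · congr 1
    refine congrArg _ (funext fun b => ?_)
    rw [PMF.map_comp, PMF.map_comp]
    rfl
  · obtain ⟨t, ht, rfl⟩ := (PMF.mem_support_map_iff _ _ _).1 hα
    rw [length_oneStep, length_eq_of_mem_support_uniformBits ht]

/-- **Uniform side**: `D'` on `U_{d(N)+1}` accepts with the probability of `D` on the hybrid `H^{k+1}`.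
[cite: Goldreich2001, Thm. 3.3.3 (proof, Claims 3.3.3.1–3.3.3.2)] -/
theorem acceptPMF_red_uniform {D : RandAlg (List Bool) Bool} {cl : ℕ → ℕ} {N k a : ℕ} (hk : k < (TP dP qP).eval N) (ha : a ≤ qP.eval N)
    (hcl : cl (2 * N + 2 + (dP.eval N + 1)) = (D.coinLen (2 * N + 2 + (TP dP qP).eval N) * bm2 qP N + a) * bm1 dP qP N + k) :
    acceptPMF (red G dP qP D cl) N (uniformBits (dP.eval N + 1)) =
      acceptPMF D N (PRGStretch.hyb (oneStep G N a) (dP.eval N) ((TP dP qP).eval N) (k + 1)) := by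
  rw [acceptPMF_red hk ha hcl _ fun α hα => length_eq_of_mem_support_uniformBits hα]
  congr 1
  have hE : (uniformBits (dP.eval N + 1)).map (PRGStretch.ext (oneStep G N a) ((TP dP qP).eval N - k - 1)) =
      (uniformBits 1).bind fun c => (uniformBits (dP.eval N)).map fun t => c ++ gen (oneStep G N a) ((TP dP qP).eval N - k - 1) t := by
    rw [uniformBits_succ_eq_bind, PMF.map_bind]
    refine pmf_bind_congr_of_mem_support _ fun c hc => ?_
    have hcl' : c.length = 1 := length_eq_of_mem_support_uniformBits hc
    rw [PMF.map_comp]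
    refine congrArg (fun f => (uniformBits (dP.eval N)).map f) (funext fun t => ?_)
    simp only [Function.comp_apply, PRGStretch.ext]
    rw [List.take_append_of_le_length hcl'.ge, List.take_of_length_le hcl'.le,
      List.drop_append_of_le_length hcl'.ge, List.drop_of_length_le hcl'.le, List.nil_append]
  rw [hE, PRGStretch.hyb, ← uniformBits_add k 1, PMF.bind_bind]
  refine congrArg _ (funext fun b => ?_)
  rw [PMF.map_bind, PMF.bind_map]
  refine congrArg _ (funext fun c => ?_)
  simp only [Function.comp_apply, PMF.map_comp]
  refine congrArg (fun f => (uniformBits (dP.eval N)).map f) (funext fun t => ?_)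
  simp only [Function.comp_apply, List.append_assoc, Nat.sub_sub]

end Laws

/-! ### Telescoping, the advice budget, and Prop. 3.3.4 with advice -/

section Main

/-- `p_k = Pr[D(1^N, H^k) = 1]` for the candidate of advice `a`. [cite: Goldreich2001, Thm. 3.3.3 (proof: d^k(n))] -/
noncomputable def pH (D : RandAlg (List Bool) Bool) (N a k : ℕ) : ℝ :=
  (acceptPMF D N (PRGStretch.hyb (oneStep G N a) (dP.eval N) ((TP dP qP).eval N) k) true).toReal

/-- **The attacked hybrid index** `k*(N)`: a maximiser of the neighbouring gap for the good candidate.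
[cite: Goldreich2001, Thm. 3.3.3 (proof)] -/
noncomputable def kStar (D : RandAlg (List Bool) Bool) (aStar : ℕ → ℕ) (N : ℕ) : ℕ :=
  Classical.choose (exists_gap_ge (pH G dP qP D N (aStar N)) (TP_pos dP qP N))

/-- The attacked index is below `T(N)` and its gap dominates `Δ(N)/T(N)`. [cite: Goldreich2001, Thm. 3.3.3 (proof)] -/
theorem kStar_spec (D : RandAlg (List Bool) Bool) (aStar : ℕ → ℕ) (N : ℕ) :
    kStar G dP qP D aStar N < (TP dP qP).eval N ∧
      |pH G dP qP D N (aStar N) 0 - pH G dP qP D N (aStar N) ((TP dP qP).eval N)| ≤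
        (TP dP qP).eval N * |pH G dP qP D N (aStar N) (kStar G dP qP D aStar N) - pH G dP qP D N (aStar N) (kStar G dP qP D aStar N + 1)| :=
  Classical.choose_spec (exists_gap_ge (pH G dP qP D N (aStar N)) (TP_pos dP qP N))

/-- **The level of a game-input length**: the largest `N ≤ L` with `2N + 3 + d(N) ≤ L`. [folklore] -/
def lvlOf (L : ℕ) : ℕ := Nat.findGreatest (fun N => 2 * N + 3 + dP.eval N ≤ L) L

/-- `lvlOf (2N + 3 + d N) = N` (the game-input length determines the level). [folklore] -/
theorem lvlOf_eq (N : ℕ) : lvlOf dP (2 * N + 2 + (dP.eval N + 1)) = N := by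
  unfold lvlOf
  rw [Nat.findGreatest_eq_iff]
  refine ⟨by omega, fun _ => by omega, fun m hNm _ hm => ?_⟩
  have := TM2Iter.eval_mono dP hNm.le
  omega

/-- `lvlOf L ≤ L`. [folklore] -/
theorem lvlOf_le (L : ℕ) : lvlOf dP L ≤ L := Nat.findGreatest_le _

/-- **The coin budget of `D'`**: at the game-input length of level `N`, the number
`(κ(N)·B₂(N) + a*(N))·B₁(N) + k*(N)` — the coin count of `D` on `T(N)`-bit samples, the advice, and the
attacked index. [cite: HastadImpagliazzoLevinLuby1999, Def. 3.1.1 (mildly non-uniform adversary: aₙ as an additional input)] -/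
noncomputable def redCl (D : RandAlg (List Bool) Bool) (aStar : ℕ → ℕ) (L : ℕ) : ℕ :=
  (D.coinLen (2 * lvlOf dP L + 2 + (TP dP qP).eval (lvlOf dP L)) * bm2 qP (lvlOf dP L) + aStar (lvlOf dP L)) * bm1 dP qP (lvlOf dP L) +
    kStar G dP qP D aStar (lvlOf dP L)

/-- The budget at the game-input length of level `N`. [folklore] -/
theorem redCl_eq (D : RandAlg (List Bool) Bool) (aStar : ℕ → ℕ) (N : ℕ) :
    redCl G dP qP D aStar (2 * N + 2 + (dP.eval N + 1)) =
      (D.coinLen (2 * N + 2 + (TP dP qP).eval N) * bm2 qP N + aStar N) * bm1 dP qP N + kStar G dP qP D aStar N := by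
  rw [redCl, lvlOf_eq]

/-- **The budget is polynomially bounded.** [folklore] -/
theorem redCl_le {D : RandAlg (List Bool) Bool} (hD : IsPPT D encodeBool) {aStar : ℕ → ℕ} (ha : ∀ N, aStar N ≤ qP.eval N) :
    ∃ q : Polynomial ℕ, ∀ L, redCl G dP qP D aStar L ≤ q.eval L := by
  obtain ⟨p, hp⟩ := hD.2
  refine ⟨(p.comp (C 2 * X + C 2 + TP dP qP) * (qP + 1) + qP) * (TP dP qP + 1) + TP dP qP, fun L => ?_⟩
  set N := lvlOf dP L with hN
  have hNL : N ≤ L := lvlOf_le dP L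
  have hT : (TP dP qP).eval N ≤ (TP dP qP).eval L := TM2Iter.eval_mono _ hNL
  have hq : qP.eval N ≤ qP.eval L := TM2Iter.eval_mono _ hNL
  have hk : kStar G dP qP D aStar N ≤ (TP dP qP).eval L := (kStar_spec G dP qP D aStar N).1.le.trans hT
  have h1 : D.coinLen (2 * N + 2 + (TP dP qP).eval N) ≤ (p.comp (C 2 * X + C 2 + TP dP qP)).eval L := by
    simp only [eval_comp, eval_add, eval_mul, eval_C, eval_X]
    exact (hp _).trans (TM2Iter.eval_mono p (by omega))
  have h2 : bm2 qP N ≤ (qP + 1).eval L := by rw [eval_add, eval_one]; unfold bm2; omega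
  have h3 : bm1 dP qP N ≤ (TP dP qP + 1).eval L := by rw [eval_add, eval_one]; unfold bm1; omega
  have h4 : aStar N ≤ qP.eval L := (ha N).trans hq
  rw [redCl, ← hN, eval_add, eval_mul, eval_add, eval_mul]
  exact Nat.add_le_add (Nat.mul_le_mul (Nat.add_le_add (Nat.mul_le_mul h1 h2) h4) h3) hk

/-- `H^0` is the stretched candidate's output. [cite: Goldreich2001, Thm. 3.3.3 (proof: "H^0_n equals G(U_n)")] -/
theorem hyb_zero' (G₁ : List Bool → List Bool) (n T : ℕ) : PRGStretch.hyb G₁ n T 0 = (uniformBits n).map (gen G₁ T) := by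
  rw [PRGStretch.hyb, uniformBits_zero, PMF.pure_bind, Nat.sub_zero]
  rfl

variable {G dP qP}

/-- **The advantage against the stretched good candidate is at most `T(N)` times the advantage of `D'` against
its one-step version, at every `N`.** [cite: Goldreich2001, Thm. 3.3.3 (proof: "= Δ(n)/p(n)")] -/
theorem distAdvantage_le_mul_red (D : RandAlg (List Bool) Bool) {aStar : ℕ → ℕ} (ha : ∀ N, aStar N ≤ qP.eval N) (N : ℕ) :
    distAdvantage D (fun N => (uniformBits (dP.eval N)).map (gen (oneStep G N (aStar N)) ((TP dP qP).eval N)))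
        (uniformEnsemble fun N => (TP dP qP).eval N) N ≤
      (TP dP qP).eval N * distAdvantage (red G dP qP D (redCl G dP qP D aStar))
        (fun N => (uniformBits (dP.eval N)).map (oneStep G N (aStar N))) (uniformEnsemble fun N => dP.eval N + 1) N := by
  obtain ⟨hk, hgap⟩ := kStar_spec G dP qP D aStar N
  have hcl := redCl_eq G dP qP D aStar N
  have hadv : distAdvantage D (fun N => (uniformBits (dP.eval N)).map (gen (oneStep G N (aStar N)) ((TP dP qP).eval N)))
      (uniformEnsemble fun N => (TP dP qP).eval N) N =
      |pH G dP qP D N (aStar N) 0 - pH G dP qP D N (aStar N) ((TP dP qP).eval N)| := by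
    rw [pH, pH, hyb_zero', PRGStretch.hyb_self]
    rfl
  have hred : distAdvantage (red G dP qP D (redCl G dP qP D aStar)) (fun N => (uniformBits (dP.eval N)).map (oneStep G N (aStar N)))
      (uniformEnsemble fun N => dP.eval N + 1) N =
      |pH G dP qP D N (aStar N) (kStar G dP qP D aStar N) - pH G dP qP D N (aStar N) (kStar G dP qP D aStar N + 1)| := by
    rw [pH, pH, ← acceptPMF_red_map hk (ha N) hcl, ← acceptPMF_red_uniform hk (ha N) hcl]
    rfl
  rw [hadv, hred]
  exact hgap

/-- **Prop. 3.3.4 for a mildly non-uniform one-step generator (level form).** If `G ∈ FP` and the good one-step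
candidates `N ↦ oneStep G N (a*(N)) (U_{d(N)})` (`a*(N) ≤ q(N)`) are pseudorandom against `U_{d(N)+1}`, then
the stretched good candidates `N ↦ gen (oneStep G N (a*(N))) T(N) (U_{d(N)})` are pseudorandom against
`U_{T(N)}`. [cite: HastadImpagliazzoLevinLuby1999, Prop. 3.3.4 (with Prop. 4.8.1, remark) ; Goldreich2001 Thm. 3.3.3] -/
theorem isPseudorandom_stretch (hG : G ∈ FP) {aStar : ℕ → ℕ} (ha : ∀ N, aStar N ≤ qP.eval N)
    (hps : IsPseudorandom (fun N => (uniformBits (dP.eval N)).map (oneStep G N (aStar N))) fun N => dP.eval N + 1) :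
    IsPseudorandom (fun N => (uniformBits (dP.eval N)).map (gen (oneStep G N (aStar N)) ((TP dP qP).eval N))) fun N => (TP dP qP).eval N := by
  intro D hD
  have hPPT : IsPPT (red G dP qP D (redCl G dP qP D aStar)) encodeBool := isPPT_red G dP qP hD hG (redCl_le G dP qP hD ha)
  have hdec := hps _ hPPT
  have hpoly := hdec.polynomial_mul ((TP dP qP).map (Nat.castRingHom ℝ))
  refine hpoly.trans_abs_le fun N => ?_
  have heval : ((TP dP qP).map (Nat.castRingHom ℝ)).eval (N : ℝ) = (((TP dP qP).eval N : ℕ) : ℝ) := by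
    rw [eval_map, eval₂_at_natCast, eq_natCast, Nat.cast_id]
  rw [heval, abs_of_nonneg (distAdvantage_nonneg _ _ _ _), abs_of_nonneg
    (mul_nonneg (Nat.cast_nonneg _) (distAdvantage_nonneg _ _ _ _))]
  exact distAdvantage_le_mul_red D ha N

end Main

end AdvStretch

open AdvStretch

/-! ### Prop. 4.8.1: pseudorandom generators from an advice-indexed level family -/

/-- `(m·a)` is strictly increasing. [folklore] -/
theorem AdvStretch.strictMono_seedLen (dP qP : Polynomial ℕ) : StrictMono fun N => (mP qP).eval N * (aP dP).eval N := by
  refine strictMono_nat_of_lt_succ fun N => ?_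
  simp only [mP_eval, aP_eval]
  have h1 : qP.eval N ≤ qP.eval (N + 1) := TM2Iter.eval_mono _ (Nat.le_succ N)
  have h2 : dP.eval N ≤ dP.eval (N + 1) := TM2Iter.eval_mono _ (Nat.le_succ N)
  calc (qP.eval N + 1) * (dP.eval N + N) < (qP.eval N + 1) * (dP.eval (N + 1) + (N + 1)) :=
        Nat.mul_lt_mul_of_pos_left (by omega) (by omega)
    _ ≤ (qP.eval (N + 1) + 1) * (dP.eval (N + 1) + (N + 1)) := Nat.mul_le_mul_right _ (by omega)

/-- **The final generator of a level**: XOR of the `q(N)+1` stretched candidates on independent seeds, as one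
`FP` sampler `⟨1^N, R⟩ ↦ ⊕ᵢ Sx⟨1^N, ⟨1ⁱ, block i of R⟩⟩`. [cite: HastadImpagliazzoLevinLuby1999, Prop. 4.8.1 (g'(x') = ⊕ g(i, x'ᵢ))] -/
noncomputable def AdvStretch.Sxor (G : List Bool → List Bool) (dP qP : Polynomial ℕ) : List Bool → List Bool :=
  xorFoldFn (Sx G dP qP) (aP dP) (mP qP) ∘ fanoutFn fstF (ProdSamp.tupleFn (Sx G dP qP) (aP dP) (mP qP))

/-- `Sxor ∈ FP`. [folklore] -/
theorem AdvStretch.Sxor_mem_FP {G : List Bool → List Bool} (dP qP : Polynomial ℕ) (hG : G ∈ FP) : Sxor G dP qP ∈ FP :=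
  comp_mem_FP (xorFoldFn_mem_FP _ _ _ (Sx_mem_FP G dP qP hG))
    (fanoutFn_mem_FP fstF_mem_FP (ProdSamp.tupleFn_mem_FP _ _ _ (Sx_mem_FP G dP qP hG)))

/-- **Value of `Sxor` on a genuine input.** [folklore] -/
theorem AdvStretch.Sxor_apply (G : List Bool → List Bool) (dP qP : Polynomial ℕ) {N : ℕ} {R : List Bool}
    (hR : R.length = (mP qP).eval N * (aP dP).eval N) :
    Sxor G dP qP (boolPair (unaryEncodeNat N) R) =
      xorBlocks ((TP dP qP).eval N) ((List.range ((mP qP).eval N)).map fun i =>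
        Sx G dP qP (boolPair (unaryEncodeNat N) (boolPair (ones i) (blk ((aP dP).eval N) i R)))) := by
  have hb := hasOutLenI_Sx G dP qP
  have hbn : (TP dP qP).eval N ≤ 2 * N + 2 + (mP qP).eval N * (aP dP).eval N + 1 := by
    rw [TP_eval, mP_eval, aP_eval]; omega
  have hbs : ∀ b ∈ (List.range ((mP qP).eval N)).map (fun i =>
      Sx G dP qP (boolPair (unaryEncodeNat N) (boolPair (ones i) (blk ((aP dP).eval N) i R)))), b.length = (TP dP qP).eval N := by
    intro b hb'
    rw [List.mem_map] at hb'
    obtain ⟨i, hi, rfl⟩ := hb'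
    rw [List.mem_range] at hi
    exact hb N i _ (Hybrid.length_blk_of_le (by rw [hR]; exact Nat.mul_le_mul_right _ hi))
  rw [Sxor, Function.comp_apply, fanoutFn_apply, fstF_boolPair, ProdSamp.tupleFn_apply hb hbn hR,
    xorFoldFn_apply hb (length_flatten_map_range fun i hi => hbs _ (List.mem_map.2 ⟨i, List.mem_range.2 hi, rfl⟩))]
  congr 1
  have h := map_blk_flatten _ hbs
  rw [List.length_map, List.length_range] at h
  exact h

/-- **HILL's Prop. 4.8.1 with Prop. 3.3.4, level form: pseudorandom generators from a mildly non-uniform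
one-bit-stretch level family.** Let `G ∈ FP` read `⟨1^N, ⟨1^a, s⟩⟩` (level `N`, advice `a`, seed `s`), let the
seed length be a polynomial `d(N)` and the advice range `a ≤ q(N)` polynomial. If for SOME advice sequence
`a*(N) ≤ q(N)` (not necessarily computable) the candidate of advice `a*(N)` maps `d(N)`-bit seeds to
`d(N)+1` bits and `N ↦ G⟨1^N, ⟨1^{a*(N)}, U_{d(N)}⟩⟩` is pseudorandom against `U_{d(N)+1}`, then pseudorandom
generators exist: stretch every candidate (`AdvStretch.Sx`, Prop. 3.3.4 / Construction 3.3.2 with the advice in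
the reduction's coin budget), XOR the `q(N)+1` stretched candidates on independent seeds
(`isPseudorandom_xorCombiner`, Prop. 4.8.1), and pass from levels to all seed lengths (`PRGExist_of_levels`).
[cite: HastadImpagliazzoLevinLuby1999, Prop. 4.8.1 with Prop. 3.3.4 (and the remark after Prop. 4.8.1)] -/
theorem PRGExist_of_advice_levels {G : List Bool → List Bool} (dP qP : Polynomial ℕ) {aStar : ℕ → ℕ}
    (hG : G ∈ FP) (ha : ∀ N, aStar N ≤ qP.eval N)
    (hlen : ∀ N s, s.length = dP.eval N → (G (boolPair (unaryEncodeNat N) (boolPair (ones (aStar N)) s))).length = dP.eval N + 1)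
    (hps : IsPseudorandom (fun N => (uniformBits (dP.eval N)).map fun s => G (boolPair (unaryEncodeNat N) (boolPair (ones (aStar N)) s)))
      fun N => dP.eval N + 1) :
    PRGExist := by
  -- Step 0: the good one-step candidate is `G` itself on genuine seeds
  have hone : (fun N => (uniformBits (dP.eval N)).map (oneStep G N (aStar N))) =
      fun N => (uniformBits (dP.eval N)).map fun s => G (boolPair (unaryEncodeNat N) (boolPair (ones (aStar N)) s)) := by
    funext N
    change (uniformBits _).bind _ = (uniformBits _).bind _
    refine pmf_bind_congr_of_mem_support _ fun s hs => ?_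
    have hsl := length_eq_of_mem_support_uniformBits hs
    simp only [Function.comp_apply]
    rw [oneStep, osW_eq_of_length G (by rw [hlen N s hsl, hsl])]
  have hps1 : IsPseudorandom (fun N => (uniformBits (dP.eval N)).map (oneStep G N (aStar N))) fun N => dP.eval N + 1 := by
    rw [hone]; exact hps
  -- Step 1: stretch (Prop. 3.3.4 with advice)
  have hst := isPseudorandom_stretch (G := G) (dP := dP) (qP := qP) hG ha hps1
  -- Step 2: XOR (Prop. 4.8.1)
  have hb := hasOutLenI_Sx G dP qP
  have hk : ∀ n, aStar n < (mP qP).eval n := fun n => by rw [mP_eval]; exact Nat.lt_succ_of_le (ha n)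
  have hgood : IsPseudorandom (seedEnsembleI (Sx G dP qP) (aP dP) aStar) fun N => (TP dP qP).eval N := by
    have hE : seedEnsembleI (Sx G dP qP) (aP dP) aStar =
        fun N => (uniformBits (dP.eval N)).map (gen (oneStep G N (aStar N)) ((TP dP qP).eval N)) := by
      funext N
      unfold seedEnsembleI
      have h1 : (fun s => Sx G dP qP (boolPair (unaryEncodeNat N) (boolPair (ones (aStar N)) s))) =
          gen (oneStep G N (aStar N)) ((TP dP qP).eval N) ∘ fun s => s.take (dP.eval N) :=
        funext fun s => by rw [Function.comp_apply, Sx_level]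
      rw [h1, ← PMF.map_comp, aP_eval, PRGPrefix.uniformBits_map_take (Nat.le_add_right _ _)]
    rw [hE]; exact hst
  have hxor := isPseudorandom_xorCombiner (Sx_mem_FP G dP qP hG) hb hk hgood
  -- Step 3: levels → all seed lengths
  set e : ℕ → ℕ := fun N => (mP qP).eval N * (aP dP).eval N with he
  have hlev : PRGExt.levelEnsemble e (Sxor G dP qP) =
      fun n => (uniformBits ((mP qP).eval n * (aP dP).eval n)).map fun R =>
        xorBlocks ((TP dP qP).eval n) ((List.range ((mP qP).eval n)).map fun i =>
          Sx G dP qP (boolPair (unaryEncodeNat n) (boolPair (ones i) (blk ((aP dP).eval n) i R)))) := by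
    funext n
    unfold PRGExt.levelEnsemble
    change (uniformBits _).bind _ = (uniformBits _).bind _
    refine pmf_bind_congr_of_mem_support _ fun R hR => ?_
    simp only [Function.comp_apply]
    rw [Sxor_apply G dP qP (length_eq_of_mem_support_uniformBits hR)]
  have hpsl : IsPseudorandom (PRGExt.levelEnsemble e (Sxor G dP qP)) fun N => (TP dP qP).eval N := by rw [hlev]; exact hxor
  have hdF : PRGExt.dF e ∈ FP := by
    have h : PRGExt.dF e = Plumb.polyFn (mP qP * aP dP) := funext fun u => by rw [PRGExt.dF, Plumb.polyFn_apply, eval_mul]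
    rw [h]; exact Plumb.polyFn_mem_FP _
  have hOut : PRGExt.OutLen e (fun N => (TP dP qP).eval N) (Sxor G dP qP) := fun n s hs => by
    rw [Sxor_apply G dP qP hs, length_xorBlocks]
  have hr : ∀ n, e n + 1 ≤ (TP dP qP).eval n := fun n => by rw [he]; simp only [TP_eval, mP_eval, aP_eval]; exact le_rfl
  exact PRGExist_of_levels (strictMono_seedLen dP qP) hdF (Sxor_mem_FP dP qP hG) hOut hr hpsl

end Literature.Computability.Cryptography
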